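import Summits.Parity.GeneralizedHardyLittlewood.Theorems.BeyondDiagonalBeatsQuarter.OffDiagDualCompletion
import HarnessLib

/-!
# Route `PrimeLevelFamEdge`, crux K_B (stmt-Parity-20343), line `diagonal_kernel_split` rev 4, plan Ω,
# sub-line **Ω-e (principal part, second lemma; OMEGA-BLUEPRINT L6) — TWISTED complete `s`-sums:
# `Σ_{s∈ℤ} e(js/h)·Φ̂(ξ₁, s/h + τ) = h·e(−jτ)·Σ_{k∈ℤ} e(−τhk)·𝓕₁Φ(ξ₁; hk + j)` — the «`s`-periodic parts» of the
# principal term sample the physical weight at the points `y₂ ≡ j (mod h)`**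

In the principal part of the class count (GATE G2 §(a) a8P) the `s`-sum carries an `s`-PERIODIC arithmetic weight
`w(s)` (the density `1/φ(|h₁|/(cs,h₁))` and the solvability indicator depend on `s mod h₁`); expanding `w` in additive
characters `e(js/h₁)` reduces everything to twisted complete sums. `OffDiagDualCompletion` (p639457) did `j = 0`
(«`Σ_s Φ_c = 0`»: the untwisted complete sum re-discretises `y₂` onto `hℤ` and vanishes when the box misses `hℤ`); here the
general twist, by TRANSLATION on the physical side:

* `ker_sub_left`, `fourier_translate` — `𝓕(t ↦ F(t + j))(ξ) = e(jξ)·𝓕F(ξ)`; `fourier_translate_isBigO` (decay kept);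
* **`tsum_fourierChar_mul_fourier_shift_eq`** — `Σ_s e(js/h)·𝓕F(s/h + τ) = h·e(−jτ)·Σ_k e(−τhk)·F(hk + j)`;
* **`tsum_fourierChar_mul_fourier2_shift_eq`** — the same for `fourier2 Φ ξ₁ (·)` with `F(hk + j) ↦ 𝓕(t₁ ↦ Φ(t₁, hk + j))(ξ₁)`;
* **`tsum_fourierChar_mul_fourier2_shift_eq_single`** — if `Φ(t₁,t₂) ≠ 0` forces `0 < t₂ < h` and `0 ≤ j < h`, only `k = 0`
  survives: `Σ_s e(js/h)·Φ̂(ξ₁, s/h + τ) = h·e(−jτ)·𝓕(t₁ ↦ Φ(t₁, j))(ξ₁)` — the twisted complete sum SAMPLES the box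
  weight at the single height `y₂ = j` (G2 a8P: «`s`-periodic parts = transition windows»).

Folklore Fourier analysis; theorems only; standard axioms. Helper toward `stub_offDiagBelowSlack_io`; closes nothing.
«The programme SEARCHES and TYPES; no claim about Landau–Siegel zeros, Theorems 1–2 of arXiv:2211.02515 or
a repaired Margin232 until a kernel theorem says so.»
-/

noncomputable section

open Real MeasureTheory Filter Complex Set
open scoped FourierTransform Topology ContDiff

namespace Summit.Parity.GeneralizedHardyLittlewood.Theorems.BeyondDiagonalBeatsQuarter.OffDiag

open Literature.NumberTheory.Sieve.FriedlanderIwaniecPrimes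
open OffDiagPoissonTwisted (poissonHypotheses_of_contDiff)

/-! ### Translation -/

/-- `e(−(u−j)ξ) = e(−uξ)·e(jξ)` for the Fourier kernel. [folklore] -/
theorem ker_sub_left (u j ξ : ℝ) :
    Literature.NumberTheory.Sieve.FriedlanderIwaniecPrimes.ker (u - j) ξ =
      Literature.NumberTheory.Sieve.FriedlanderIwaniecPrimes.ker u ξ * (𝐞 (j * ξ) : ℂ) := by
  rw [Literature.NumberTheory.Sieve.FriedlanderIwaniecPrimes.ker, Literature.NumberTheory.Sieve.FriedlanderIwaniecPrimes.ker,
    Real.fourierChar_apply, ← Complex.exp_add]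
  congr 1
  push_cast
  ring

/-- **Translation**: `𝓕(t ↦ F(t + j))(ξ) = e(jξ)·𝓕F(ξ)`. [folklore] -/
theorem fourier_translate (F : ℝ → ℂ) (j ξ : ℝ) :
    𝓕 (fun t : ℝ ↦ F (t + j)) ξ = (𝐞 (j * ξ) : ℂ) * 𝓕 F ξ := by
  rw [fourier_eq_integral_ker, fourier_eq_integral_ker]
  have h := integral_add_right_eq_self (μ := (volume : Measure ℝ))
    (fun u : ℝ ↦ Literature.NumberTheory.Sieve.FriedlanderIwaniecPrimes.ker (u - j) ξ * F u) j
  simp only [add_sub_cancel_right] at h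
  -- `h : ∫ v, ker v ξ * F (v + j) = ∫ u, ker (u - j) ξ * F u`
  rw [h]
  simp_rw [ker_sub_left]
  rw [← integral_const_mul]
  refine integral_congr_ae (Eventually.of_forall fun u ↦ ?_)
  simp only
  ring

/-- The decay `𝓕F = O(|ξ|⁻²)` survives translation (the transform only picks up a unimodular factor). [folklore] -/
theorem fourier_translate_isBigO {F : ℝ → ℂ} (hdec : 𝓕 F =O[cocompact ℝ] fun ξ : ℝ ↦ |ξ| ^ (-2 : ℝ)) (j : ℝ) :
    𝓕 (fun t : ℝ ↦ F (t + j)) =O[cocompact ℝ] fun ξ : ℝ ↦ |ξ| ^ (-2 : ℝ) := by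
  refine (hdec.norm_left.congr_left fun ξ ↦ ?_).of_norm_left
  rw [fourier_translate, norm_mul, Circle.norm_coe, one_mul]

/-! ### Twisted complete sums -/

/-- **Twisted complete shifted-lattice sums**: for `F` continuous of compact support with `𝓕F = O(|ξ|⁻²)`, `h ≥ 1`,
`τ, j ∈ ℝ`: `Σ_{s∈ℤ} e(js/h)·𝓕F(s/h + τ) = h·e(−jτ)·Σ_{k∈ℤ} e(−τhk)·F(hk + j)`. [folklore] -/
theorem tsum_fourierChar_mul_fourier_shift_eq {F : ℝ → ℂ} (hFc : Continuous F) (hFs : HasCompactSupport F)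
    (hdec : 𝓕 F =O[cocompact ℝ] fun ξ : ℝ ↦ |ξ| ^ (-2 : ℝ)) {h : ℕ} (hh : 0 < h) (τ j : ℝ) :
    ∑' s : ℤ, (𝐞 (j * ((s : ℝ) / h)) : ℂ) * 𝓕 F ((s : ℝ) / h + τ) =
      (h : ℂ) * (𝐞 (-(j * τ)) : ℂ) * ∑' k : ℤ, (𝐞 (-(τ * (h * k))) : ℂ) * F (h * k + j) := by
  -- the translate `F_j = F(· + j)`
  have hFjc : Continuous fun t : ℝ ↦ F (t + j) := hFc.comp (continuous_id.add continuous_const)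
  have hFjs : HasCompactSupport fun t : ℝ ↦ F (t + j) := by
    have : (fun t : ℝ ↦ F (t + j)) = F ∘ (Homeomorph.addRight j) := by funext t; rfl
    rw [this]; exact hFs.comp_homeomorph _
  have hmain := tsum_fourier_shift_eq hFjc hFjs (fourier_translate_isBigO hdec j) hh τ
  -- `e(js/h)·𝓕F(s/h+τ) = e(−jτ)·𝓕F_j(s/h+τ)`
  have hterm : ∀ s : ℤ, (𝐞 (j * ((s : ℝ) / h)) : ℂ) * 𝓕 F ((s : ℝ) / h + τ) =
      (𝐞 (-(j * τ)) : ℂ) * 𝓕 (fun t : ℝ ↦ F (t + j)) ((s : ℝ) / h + τ) := by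
    intro s
    rw [fourier_translate, ← mul_assoc, ← Circle.coe_mul, ← AddChar.map_add_eq_mul]
    congr 2
    ring
  simp_rw [hterm]
  rw [tsum_mul_left, hmain]
  ring

section TwoDim

variable {Φ : ℝ → ℝ → ℂ}

/-- **Twisted complete `s`-sums of the box transform**: for `uncurry Φ` smooth of compact support, `h ≥ 1`,
`τ, j, ξ₁ ∈ ℝ`: `Σ_{s∈ℤ} e(js/h)·fourier2 Φ ξ₁ (s/h + τ) = h·e(−jτ)·Σ_{k∈ℤ} e(−τhk)·𝓕(t₁ ↦ Φ(t₁, hk + j))(ξ₁)`. [folklore] -/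
theorem tsum_fourierChar_mul_fourier2_shift_eq (hΦ : ContDiff ℝ ∞ (Function.uncurry Φ))
    (hΦc : HasCompactSupport (Function.uncurry Φ)) {h : ℕ} (hh : 0 < h) (τ j ξ₁ : ℝ) :
    ∑' s : ℤ, (𝐞 (j * ((s : ℝ) / h)) : ℂ) * fourier2 Φ ξ₁ ((s : ℝ) / h + τ) =
      (h : ℂ) * (𝐞 (-(j * τ)) : ℂ) *
        ∑' k : ℤ, (𝐞 (-(τ * (h * k))) : ℂ) * 𝓕 (fun t₁ : ℝ ↦ Φ t₁ (h * k + j)) ξ₁ := by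
  obtain ⟨R, C₁, hR, hbox, hc, hs₁, hs₂, hC⟩ := poissonHypotheses_of_contDiff hΦ hΦc
  obtain ⟨R', C₁', hR', hbox', hc', hs₁', hs₂', hC'⟩ :=
    poissonHypotheses_of_contDiff (contDiff_uncurry_swap hΦ) (hasCompactSupport_uncurry_swap hΦc)
  simp_rw [fourier2_eq_fourier_sliceFourier_swap hbox hc]
  exact tsum_fourierChar_mul_fourier_shift_eq (continuous_sliceFourier hbox' hc' ξ₁)
    (hasCompactSupport_sliceFourier hbox' ξ₁) (fourier_sliceFourier_isBigO hbox' hc' hR' hs₁' hC' ξ₁) hh τ j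

/-- **The twisted complete sum SAMPLES the box at one height**: if `Φ(t₁,t₂) ≠ 0` forces `0 < t₂ < h` and
`0 ≤ j < h`, then `Σ_{s∈ℤ} e(js/h)·fourier2 Φ ξ₁ (s/h + τ) = h·e(−jτ)·𝓕(t₁ ↦ Φ(t₁, j))(ξ₁)` (only `k = 0` meets the
support). G2 §(a) a8P: the `s`-periodic parts of the principal term. [folklore] -/
theorem tsum_fourierChar_mul_fourier2_shift_eq_single (hΦ : ContDiff ℝ ∞ (Function.uncurry Φ))
    (hΦc : HasCompactSupport (Function.uncurry Φ)) {h : ℕ} (hh : 0 < h)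
    (hsupp : ∀ t₁ t₂, Φ t₁ t₂ ≠ 0 → 0 < t₂ ∧ t₂ < h) {j : ℝ} (hj0 : 0 ≤ j) (hjh : j < h) (τ ξ₁ : ℝ) :
    ∑' s : ℤ, (𝐞 (j * ((s : ℝ) / h)) : ℂ) * fourier2 Φ ξ₁ ((s : ℝ) / h + τ) =
      (h : ℂ) * (𝐞 (-(j * τ)) : ℂ) * 𝓕 (fun t₁ : ℝ ↦ Φ t₁ j) ξ₁ := by
  rw [tsum_fourierChar_mul_fourier2_shift_eq hΦ hΦc hh]
  have hhr : (0 : ℝ) < h := by exact_mod_cast hh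
  -- every `k ≠ 0` samples outside the support
  have hzero : ∀ k : ℤ, k ≠ 0 → (fun t₁ : ℝ ↦ Φ t₁ (h * k + j)) = fun _ ↦ 0 := by
    intro k hk
    funext t₁
    by_contra hne
    obtain ⟨h1, h2⟩ := hsupp t₁ _ hne
    rcases lt_or_gt_of_ne hk with hk' | hk'
    · have : (k : ℝ) ≤ -1 := by exact_mod_cast Int.le_sub_one_of_lt hk'
      nlinarith
    · have : (1 : ℝ) ≤ k := by exact_mod_cast hk'
      nlinarith
  have hterm : ∀ k : ℤ, k ≠ 0 →
      (𝐞 (-(τ * (h * k))) : ℂ) * 𝓕 (fun t₁ : ℝ ↦ Φ t₁ (h * k + j)) ξ₁ = 0 := by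
    intro k hk
    rw [hzero k hk, fourier_eq_integral_ker]
    simp
  rw [tsum_eq_single 0 (fun k hk ↦ hterm k hk)]
  simp

end TwoDim

end Summit.Parity.GeneralizedHardyLittlewood.Theorems.BeyondDiagonalBeatsQuarter.OffDiag
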